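import Mathlib
import HarnessLib
import HarnessLib.Audit
import Summits.FinalStateConjecture.Statement
import Literature.Geometry.Lorentzian.QuasiFinalStateDecomposition
import HarnessLib.Audit.Status.Attr

/-!
Route: RootDecompShadowCensorship

CLOSED (superseded) 2026-08-30T03:54:42Z by planner-decomp-fsc-writer-1-g0-0 — reason: superseded:route-FinalStateConjecture-RootDecompCensoredShadow — superseded by route-FinalStateConjecture-RootDecompCensoredShadow — note: form (b) sibling born by signature only (25325/25326/25327/24307, rev 0 61d1d5d1670a); its glued split of GenericCoarseCapture bounced 3x gate-mechanically on the by-signature child stmt-17269 (signature does not elaborate standalone in the context of Theorems/ChannelsResolveTameDevelopmentsR/Negati. The file is kept as the record of this route; refuted decls are indexed as negative knowledge (`ledger negatives`).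

# Route RootDecompShadowCensorship — Root decomposition N5b «ShadowCensorship» (form b) — N5 leaves
by signature (GenericCoarseCapture, MesoscopicRingdown, RingdownJunction, PerturbativeCell) +
censorship carve of 25325 as glued split

DECOMPOSITION CELL decomp-fsc (D-0178; doctrine D-0170/0171/0172), summit S =
`_root_.FinalStateConjecture` exactly as typed; LADDER rung 0 — NOTHING IN THIS FILE PROVES THE
FINAL STATE CONJECTURE. OR-SIBLING REFINEMENT of the cell's file of record
Theses/RootDecompCaptureCells.lean (route-FinalStateConjecture-RootDecompCaptureCells, node N5,
whose crux WildCell stmt-24308 carries the filed gen-1 split 25325 ∧ 25326 ∧ 25327): this file =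
node N5b «ShadowCensorship» = lens decomp-fsc-lens-6 gen 3 «ShadowCensorshipCarve», CLEARED by the
critic decomp-fsc-crit-1-g0 (verdict line on HOME/STATUS.md, quoted in the BORN line), filed as a
THIN SIBLING ROUTE under the critic's standing rule 03:00:14Z in FILING FORM (b) (RULING 03:45:22Z):
the route is BORN with its top level BY SIGNATURE only — GenericCoarseCapture = stmt-25325,
MesoscopicRingdown = stmt-25326, RingdownJunction = stmt-25327, PerturbativeCell = stmt-24307,
`closes` over exactly these four (the file of record's `closes` shape with WildCell rebuilt from its
born gen-1 children) — and the lens-6 g3 cut is then filed ON THIS ROUTE as the GLUED SPLIT of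
GenericCoarseCapture (`--split GenericCoarseCapture --into TameCensorship CensoredGrossCapture
CensorshipShadowJunction --glue 'TameCensorship → CensoredGrossCapture → CensorshipShadowJunction →
GenericCoarseCapture'`, TameCensorship = stmt-17269 by signature), so that exactness lives on the
ledger as a glue item (x-caps max_depth 1 forbids the split on the file of record, where 25325 is
already a child of WildCell stmt-24308). DOMINATION POINTER for provers served A = stmt-25325
GenericCoarseCapture: «A ⟺ TameCensorship ∧ CensoredGrossCapture ∧ CensorshipShadowJunction (kernel
`genericCoarseCapture_iff_pieces`, HOME/decomp-fsc-lens-6/g3/ShadowCensorshipCarve.lean @beb065f9);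
attack CensoredGrossCapture here (and WeakCosmicCensorshipTame = stmt-17269 on its own routes), not
A». The whole AND/OR tree is kept in HOME/TREE.md (HOME = run/shared/lean/pub/decomp-fsc). Writer
checks: the four by-signature statements are byte-EQUAL to the ledger signatures of stmt-17269 /
25326 / 25327 / 24307; the two new pieces carry 25325's lets verbatim (common prefix 2042/2174
chars, then the new `let Censored`); native glue check OK (lens filing/native.out and my re-run).
It suffices to show six things, and the split is exact (FinalStateConjecture ⟺ A₁ ∧ A₂ ∧ A₃ ∧ M ∧ J
∧ PC, kernel `summit_iff_six` in the
cell file HOME/decomp-fsc-lens-6/g3/ShadowCensorshipCarve.lean; `genericCoarseCapture_iff_split` in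
g3/SplitCheck.lean against the tree decl):
(A₁) TameCensorship — verbatim the registered item stmt-FinalStateConjecture-17269 (tame weak cosmic
censorship, cited by signature);
(A₂) CensoredGrossCapture — among CENSORED admissible data the UNIT SHADOW Q_Σ of the summit
property (every MGHD is unit-captured: a
sub-extremal 1-quasi final state decomposition in the Statement's C² chart currency with every rider
kept) is reached along a tame line
from every datum failing it; (A₃) CensorshipShadowJunction — at naked data a censorship-exit line
yields a shadow-exit line (the ∧-toll);
(M) MesoscopicRingdown — verbatim stmt-FinalStateConjecture-25326; (J) RingdownJunction — verbatim
stmt-FinalStateConjecture-25327;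
(PC) PerturbativeCell — verbatim stmt-FinalStateConjecture-24307. This is the ALTERNATIVE
DECOMPOSITION (D-0019: a separate thin route
sharing decls) of the born node GenericCoarseCapture (stmt-FinalStateConjecture-25325) of
route-FinalStateConjecture-RootDecompCaptureCells:
GenericCoarseCapture ⟺ A₁ ∧ A₂ ∧ A₃; every other item of the parent route's cone is attached BY
SIGNATURE (25326, 25327, 24307), every cut once.
Cell decomp-fsc, lens 6 «barrier-complement carving», generation 3.
Lean: `GenericCoarseCapture ∧ MesoscopicRingdown ∧ RingdownJunction ∧ PerturbativeCell` (the four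
by-signature decls of this file; `closes` in folder/n5c/glue.lean; the lens-6 pieces enter as the
glued split of GenericCoarseCapture)

## Assembly
Pure logic inside `closes` (folder/n5c/glue.lean, 0 sorry; kernel-checked in
folder/n5c/Sketch.lean): excluded middle on «d is unit-captured» (PerturbativeCell cures the
captured case), then on the unit shadow Q at d (MesoscopicRingdown), else GenericCoarseCapture's
Q-exit through d upgraded to a P-exit by RingdownJunction — the file of record's `closes` with
WildCell (stmt-24308) rebuilt inline from its born children (kernel `wildCell_of_pieces`,
folder/n5g2).

Rationale: WHY THIS LINE. The gen-2 residual GenericCoarseCapture («the unit shadow Q_Σ is tame-generic») lies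
outside the technique class of all nine late-time
barrier families of Literature/Barriers/FinalStateConjecture, and exactly one catalogued family
still touches it: NakedSingularityInstability,
because censorship is a conjunct of Q_Σ. The RELATIVE GENERICITY DOOR (Christodoulou1999 p. A24;
tree
`InitialDataSet.isTameChristodoulouGeneric_of_relative_exceptional`: a generic hypothesis enters a
generic conclusion along its curves,
never by conjunction — tree negative `isTameChristodoulouGeneric_and_fails`) applied at that
conjunct OF THE SHADOW carves the family out:
A ⟺ A₁ ∧ A₂ ∧ A₃ with A₁ = 17269 by name, A₂ the first item of the decomposition cell on which NO
catalogued barrier family and no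
registered hard core bears (17308 GenericCensoredCapture contains 17269 and concerns the C⁰ → C²
upgrade; 10745 EternalStationaryExteriorIsKerr
concerns stationary exteriors, which are Q-good when unit-close to Kerr), and A₃ the honest ∧-toll
charged only at naked data. Both new items
are strictly below every existing censorship-cut item on both axes (population ¬Q ∧ Censored resp.
¬Censored, cure Q instead of P: kernel
`censoredGrossCapture_of_eternalCell`, `nakedShadowExit_of_censorshipCell` against the asides
stmt-24310 / 24309), so the line does what
neither RootDecompGermJunction's door (cure P, junction at all bad data) nor RootDecompCaptureCells'
asides do: it isolates the GROSS
non-perturbative dynamics of censored vacuum (finite horizon census along a generic line; no eternal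
unit-amplitude dynamics — only
time-periodicity is excluded in print, arXiv:1504.04592; honest exhaustive chart geometry) as one
killable item relieved of censorship,
of decay rates, of rigidity and of the third law. Nothing is imported from another area; the
negatives index (UniformPhotonSphereChannels) is unrelated.

RANKED CRUXES. #2 GenericCoarseCapture (crux) — = the BORN N5 child stmt-FinalStateConjecture-25325
reused BY SIGNATURE (dedup-attach; filing form (b), critic RULING 2026-08-30T03:45:22Z: this thin
sibling is born with its top level BY SIGNATURE only and the CLEARED lens-6 g3 cut
«ShadowCensorshipCarve» (TameCensorship = stmt-17269 by signature ∧ CensoredGrossCapture ∧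
CensorshipShadowJunction, exact: lens kernel genericCoarseCapture_iff_pieces @beb065f9, writer glue
genericCoarseCapture_of_pieces in folder/n5c/Sketch.lean rc 0) is filed ON THIS ROUTE as the glued
split of this item immediately after birth), text as born: [crux · gen-2 glued split of WildCell
(stmt-24308), lens-6 g2 node CoarseCaptureRingdown; RESIDUAL·WEAKER (lens kernel
genericCoarseCapture_of_summit / _of_wildCell via toQuasi + mono; ⇏ S: eternal small-amplitude
remnants — A never asks decay); sits strictly between stmt-17269 (tame WCC ⟸ A) and WildCell; leaf
IDEA-NEEDED (tame weak cosmic censorship + generic GROSS capture: finite N, no unit-amplitude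
eternal dynamics, honest chart geometry) · INSTRUMENTABLE (membership census) · barrier-free w.r.t.
the nine late-time families, nakedSingularityInstability honoured (generic form)] For every Σ the
UNIT SHADOW Q_Σ — an MGHD exists and every MGHD has complete 𝓘⁺ and carries a 1-quasi final state
decomposition (C², sub-extremal reference holes, O = exteriorOf, rays stay, honest exhaustive charts
at tolerance 1, future-oriented charts: the born Captured body at the single tolerance 1) — is
tame-Christodoulou-generic with codimension 1 in admissibleVacuumData Σ. [difficulty: open-problem]
(why it might fail: generic weak cosmic censorship for large vacuum data is open, and gross capture
can fail robustly: an open set of data with N → ∞ fragmentation, unit-amplitude eternal dynamics or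
dishonest chart geometry along every tame curve.) [Christodoulou1999, Klainerman2025,
arXiv:1412.0727, DafermosLuk2017]
#3 MesoscopicRingdown (crux) — verbatim the born item stmt-FinalStateConjecture-25326
(RootDecompCaptureCells.MesoscopicRingdown, cited by signature; dedup-attach): for every Σ and every
admissible P_Σ-exceptional datum d inside the unit shadow (Q_Σ d) that is not captured (at some
tolerance δ > 0 never eventually δ-captured), a tame exit with cure P_Σ — the mesoscopic ringdown
gap between unit capture and capture at every tolerance. [difficulty: open-problem] (why it might
fail: an eternally breathing remnant of Kerr–Schild amplitude below 1 but bounded away from 0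
(nonlinear bound state / limit cycle) persisting on a tame-open set would be unit-captured, never
captured at small tolerance, and incurable.) [arXiv:2104.11857, arXiv:2205.14808, Klainerman2025,
arXiv:1606.04014]
#4 RingdownJunction (crux) — verbatim the born item stmt-FinalStateConjecture-25327
(RootDecompCaptureCells.RingdownJunction, cited by signature; dedup-attach): for every Σ and every
admissible P_Σ-exceptional datum d outside the unit shadow (¬ Q_Σ d), a tame exit with cure Q_Σ
yields a tame exit with cure P_Σ. [difficulty: L] (why it might fail: a Cantor-like set of P-bad
parameters accumulating at 0 along every Q-exit line through some Q-exceptional datum (laminated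
ringdown failure inside the unit shadow) gives a Q-exit with no P-exit.) [Christodoulou1999,
arXiv:gr-qc/0702084, Klainerman2025]
#5 PerturbativeCell (crux) — verbatim the born item stmt-FinalStateConjecture-24307
(RootDecompCaptureCells.PerturbativeCell, cited by signature; dedup-attach): for every Σ and every
admissible P_Σ-exceptional datum d that IS captured (censored and δ-captured at every tolerance δ >
0), a tame exit with cure P_Σ — the generic third law plus gauge stitching. [difficulty:
open-problem] (why it might fail: data whose MGHDs converge to an EXACTLY EXTREMAL Kerr exterior
might fill a tame-open set (third law false in the charged model, arXiv:2211.15742; extremal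
formation conjectured critical = positive codimension, arXiv:2402.10190, unproved in vacuum).)
[Klainerman2025, arXiv:2211.15742, arXiv:2402.10190, KlainermanSzeftel2020, Hintz2026]

TWO-LAYER PLAN. Foreseen (not filed): CensoredGrossCapture ⇐ BoundedCensusGross →
UnboundedCensusExit → CensusJunction → CensoredGrossCapture, the free
population split of the censored-but-unshadowed cell by the datum's own HORIZON CENSUS fate
(finitely many holes forever vs N → ∞
fragmentation; Literature BlackHoleCensus vocabulary), k = 3, depth 1.

KILL CRITERIA. A refutation of CensoredGrossCapture (a tame-open set of censored admissible data
with no Q-good tame line — e.g. a wDist-stable eternal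
unit-amplitude censored configuration) closes the route outright (`--reason
refuted:CensoredGrossCapture`) and refutes the summit with it
(every item is S-implied: kernel `pieces_of_summit`). A refutation of CensorshipShadowJunction
forces a pivot to the merged cell form
NakedShadowExit (= TameCensorship ∧ CensorshipShadowJunction, kernel `nakedShadowExit_iff`) as one
item. A proof of GenericCoarseCapture
(stmt-25325) on the parent route moots A₁–A₃ here; a proof of WildCell (stmt-24308) moots everything
but PerturbativeCell.

NOT DECOMPOSED YET. The census / stationarity sub-structure of CensoredGrossCapture (bounded vs
unbounded horizon census; eventually stationary at unit scale vs
not) and the PDE-free support TameExitTrim (re-basing a punctured-neighbourhood cure; provable now,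
to be attached with `--supports
CensorshipShadowJunction`) are deliberately not items at open: layer-2 children / prover-level
supports later (D-0019).

CHEAPEST FALSIFIER. Membership census for CensoredGrossCapture: is there ANY known censored vacuum
evolution (numerical or exact) whose exterior never becomes
unit-C²-close to a sub-extremal Kerr–Schild chart system on exhaustive slabs — a perpetual binary, a
large breather, an N → ∞ cascade? In
print only genuinely time-periodic vacuum is excluded near 𝓘 (arXiv:1504.04592); no example is known
(lookup run 2026-08-30: corpus hybrid
+ galaxy, no hits). In Lean: the crux probes `#h21_crux_probe` on both new items are CLEAN
(g3/bc/bc7.txt) and no child or pair of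
children gives the parent by `exact? | aesop | tauto` (g3/bc/parent-probe.txt).

NUMBERS. Unit tolerance δ = 1 and regularity k = 2 in the shadow Q_Σ are the Statement's own
currency one dial-stop down (truncDeviationCk ≤ 1 on
truncated slabs of honest radius R ≥ max(r₊, 0) + 1); sub-extremality |a| < M of the REFERENCE
charts (Kerr.IsSubextremal); codimension 1,
tameness order 1 as in the Statement.

DEFINITION REQUESTS. None: every notion is in the tree (QuasiFinalStateDecomposition,
IsTameChristodoulouGeneric, exteriorOf, RaysStayInClosure, certifiedLate/Slab).

Novelty: Searches (2026-08-30): lit search --hybrid "no time-periodic asymptotically flat vacuum spacetimes"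
(6 docs; arXiv:1504.04592 p.9, Hawking–Ellis pp.376–377); lit search --hybrid "bound on the number
of black holes formed in gravitational collapse vacuum" (6 textbook docs, no bound); lit vsearch
"complete null infinity but the exterior never settles: eternal binary or breather vacuum solutions"
(6 docs, none on point); lit search --hybrid "final state conjecture finitely many Kerr black holes
moving apart generic" (6 docs: Klainerman–Szeftel 2020 pp.100–101, Daudé 2017); lit galaxy search
"time-periodic vacuum|helically symmetric|no periodic solutions" --star all (16 rows, none
relevant); lit galaxy search "naked singularities for the Einstein vacuum|weak cosmic censorship in
vacuum" --star all (0 rows); earlier this cell: Klainerman 2025 CR Mécanique §2.3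
[corpus:paper:doi-10-5802-crmeca-290 p.6].
Nearest prior art found: Christodoulou1999 (CQG 16 A23, p. A24: the genericity formulation and the
relative door, scalar-field model); arXiv:1504.04592 (Alexakis–Schlue: no genuinely time-periodic AF
vacuum near 𝓘 — the only printed no-go toward «no eternal censored dynamics»); Klainerman2025 §2.3
(orbital vs asymptotic stability as notions; no data-side generic statement); in the tree:
RootDecompGermJunction (door at censorship, cure P) and RootDecompCaptureCells asides 24309/24310
(population cut by censorship, cure P).
Delta: the censorship door is applied to the UNIT SHADOW rath  [refs: 1504.04592, paper:doi-10-5802-crmeca-290, Christodoulou1999, Klainerman2025]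

Barriers (technique_class: genericity-door, barrier-complement, coarse-capture): - technique_class: genericity-door, barrier-complement, coarse-capture
- Literature.Barriers.FinalStateConjecture.nakedSingularityInstability: TameCensorship sits INSIDE
and honours it (Part 6 nakedSingularityInstabilityNarrow records the smooth-class generic statement
as open; no descent from the BV scalar-field theorem is claimed); CensoredGrossCapture is OUTSIDE by
construction (base datum and line members censored — censorship consumed, never produced);
CensorshipShadowJunction takes TameCensorship's line as input and claims no instability mechanism.
- Literature.Barriers.FinalStateConjecture.AretakisInstability: outside — sub-extremal REFERENCE
charts capture extremal and near-extremal true horizons at unit tolerance (Kerr–Schild is smooth in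
a through a = M); the extremal threshold is PerturbativeCell's content (third law), cited by
signature, not attacked here.
- Literature.Barriers.FinalStateConjecture.KerrLinearHair: outside — no decay or mode statement;
unit closeness on truncated slabs only.
- Literature.Barriers.FinalStateConjecture.KerrSuperradiance: outside — no frequency-uniform
estimate is claimed; labels are free on the whole sub-extremal range.
- Literature.Barriers.FinalStateConjecture.PriceLawTail: outside — no rate; eventual unit closeness
only.
- Literature.Barriers.FinalStateConjecture.SbierskiTrappingObstruction: outside — no high-frequency
/ derivative-loss estimate is part of any new item; MesoscopicRingdown (by signature) is where it
lives.
- Litera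

History (route lifecycle, newest last):
- 2026-08-30T03:54:42Z · CLOSED superseded — superseded:route-FinalStateConjecture-RootDecompCensoredShadow (planner-decomp-fsc-writer-1-g0-0)

sub-problem: FinalStateConjecture · status: closed(superseded) · opened planner-decomp-fsc-writer-1-g0-0 2026-08-30T03:48:58Z · rev 0 · ledger route-FinalStateConjecture-RootDecompShadowCensorship
GENERATED by the gate from the ledger (D-0016/17). Provers cite these decls: `theorem foo : Summit.FinalStateConjecture.FinalStateConjecture.Theses.RootDecompShadowCensorship.<Decl> := …` in Summits/FinalStateConjecture/FinalStateConjecture/Theorems/<Name>.lean.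
-/

namespace Summit.FinalStateConjecture.FinalStateConjecture.Theses.RootDecompShadowCensorship

open scoped BigOperators Topology Manifold Classical MeasureTheory ProbabilityTheory Matrix InnerProductSpace ComplexConjugate ContinuousMap
open Filter Set Function TopologicalSpace MeasureTheory

attribute [summit_statement] _root_.FinalStateConjecture

/-- item stmt-FinalStateConjecture-25325 · crux · rank 2 · open · by planner
why it might fail: generic weak cosmic censorship for large vacuum data is open, and gross capture can fail robustly: an open set of data with N → ∞ fragmentation, unit-amplitude eternal dynamics or dishonest chart geometry along every tame curve.
sources: Christodoulou1999, Klainerman2025, arXiv:1412.0727, DafermosLuk2017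
[crux · gen-2 glued split of WildCell (stmt-24308), lens-6 g2 node CoarseCaptureRingdown;
RESIDUAL·WEAKER (lens kernel genericCoarseCapture_of_summit / _of_wildCell via toQuasi + mono; ⇏ S:
eternal small-amplitude remnants — A never asks decay); sits strictly between stmt-17269 (tame WCC ⟸
A) and WildCell; leaf IDEA-NEEDED (tame weak cosmic censorship + generic GROSS capture: finite N, no
unit-amplitude eternal dynamics, honest chart geometry) · INSTRUMENTABLE (membership census) ·
barrier-free w.r.t. the nine late-time families, nakedSingularityInstability honoured (generic
form)] For every Σ the UNIT SHADOW Q_Σ — an MGHD exists and every MGHD has complete 𝓘⁺ and carries a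
1-quasi final state decomposition (C², sub-extremal reference holes, O = exteriorOf, rays stay,
honest exhaustive charts at tolerance 1, future-oriented charts: the born Captured body at the
single tolerance 1) — is tame-Christodoulou-generic with codimension 1 in admissibleVacuumData Σ. -/
@[route_item "route-FinalStateConjecture-RootDecompShadowCensorship", crux]
def GenericCoarseCapture : Prop :=
  ∀ (X : Type) [TopologicalSpace X] [ChartedSpace Literature.Geometry.Lorentzian.E3 X] [IsManifold (𝓡 3) ((⊤ : ℕ∞) : WithTop ℕ∞) X] [T2Space X] [SecondCountableTopology X] [ConnectedSpace X], let Q : Literature.Geometry.Lorentzian.InitialDataSet (𝓡 3) X → Prop := fun D ↦ (∃ 𝒟 : Literature.Geometry.Lorentzian.VacuumCauchyDevelopment D, 𝒟.IsMaximal) ∧ ∀ 𝒟 : Literature.Geometry.Lorentzian.VacuumCauchyDevelopment D, 𝒟.IsMaximal → Summit.FinalStateConjecture.HasCompleteNullInfinity 𝒟.toCauchyDevelopment ∧ ∃ (O : Set 𝒟.carrier) (q : Literature.Geometry.Lorentzian.QuasiFinalStateDecomposition 𝒟.toSpacetime O 2 1), (∀ i, Literature.Geometry.Lorentzian.Kerr.IsSubextremal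 (q.mass i) (q.spin i)) ∧ O = Summit.FinalStateConjecture.exteriorOf 𝒟.toCauchyDevelopment q.charted ∧ Summit.FinalStateConjecture.RaysStayInClosure 𝒟.toCauchyDevelopment O ∧ (∃ R : Fin q.N → ℝ → ℝ, (∀ i, Tendsto (R i) atTop atTop ∧ ∀ τ, max (Literature.Geometry.Lorentzian.Kerr.rPlus (q.mass i) (q.spin i)) 0 + 1 ≤ R i τ) ∧ (∀ i, ∀ᶠ τ in atTop, 𝒟.toSpacetime.truncDeviationCk (q.background i) (q.chart i) 2 (R i τ) τ ≤ 1) ∧ ∀ τ₁ : ℝ, q.τ₀ < τ₁ → O \ q.certifiedLate R τ₁ ⊆ 𝒟.toSpacetime.metric.causalPast 𝒟.toSpacetime.timeOrientation (q.certifiedSlab R τ₁)) ∧ ((∀ i, Summit.FinalStateConjecture.IsOrthochronous (q.motion i).1) ∧ (∀ i (ρ : ℝ), ∀ᶠ τ in atTop, ∀ x ∈ (q.background i).truncTimeSlab ρ τ, 𝒟.toSpacetime.timeOrientation.IsFutureDirected (mfderiv 𝓘(ℝ, Literature.Geometry.Lorentzian.E4) (𝓡 4) (q.chart i) x (((q.motion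 i).1 : Literature.Geometry.Lorentzian.E4 ≃L[ℝ] Literature.Geometry.Lorentzian.E4) (Literature.Geometry.Lorentzian.Kerr.timeVector (q.mass i) (q.spin i) (Literature.Geometry.Lorentzian.poincareInv (q.motion i).1 (q.motion i).2 (x : Literature.Geometry.Lorentzian.E4)))))) ∧ ∀ᶠ τ in atTop, ∀ x ∈ (Literature.Geometry.Lorentzian.Minkowski.backgroundOn q.flatDomain).timeSlab τ, 𝒟.toSpacetime.timeOrientation.IsFutureDirected (mfderiv 𝓘(ℝ, Literature.Geometry.Lorentzian.E4) (𝓡 4) q.flatChart x (Literature.Geometry.Lorentzian.E4.basisVector 0))); Literature.Geometry.Lorentzian.InitialDataSet.IsTameChristodoulouGeneric (Literature.Geometry.Lorentzian.admissibleVacuumData X) Q 1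

/-- item stmt-FinalStateConjecture-25326 · crux · rank 3 · open · by planner
why it might fail: an eternally breathing remnant of Kerr–Schild amplitude below 1 but bounded away from 0 (nonlinear bound state / limit cycle) persisting on a tame-open set would be unit-captured, never captured at small tolerance, and incurable.
sources: arXiv:2104.11857, arXiv:2205.14808, Klainerman2025, arXiv:1606.04014
[crux · gen-2 glued split of WildCell (stmt-24308), lens-6 g2; WEAKER (lens kernel
mesoscopicRingdown_of_summit / _of_capturedRingdown / _of_wildCell); leaf IDEA-NEEDED
(finite-amplitude orbital ⟹ perturbative capture: no eternal remnant of C²-amplitude < 1 survives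
along a generic line; rigidity below unit amplitude) · relieved of third law / censorship / gross
capture · ATTACKABLE sub-rung (conditional ringdown from a-priori orbital control, |a| ≪ M: port of
the decay half of arXiv:2104.11857 / arXiv:2205.14808) · INSTRUMENTABLE] For every Σ, every
admissible P_Σ-exceptional datum that satisfies the unit shadow Q_Σ but is NOT captured at every
tolerance (the born Captured fails) lies on a tame immersed injective one-ended line of admissible
data, based at it, all of whose members c ≠ 0 satisfy P_Σ. -/
@[route_item "route-FinalStateConjecture-RootDecompShadowCensorship", crux]
def MesoscopicRingdown : Prop :=
  ∀ (X : Type) [TopologicalSpace X] [ChartedSpace Literature.Geometry.Lorentzian.E3 X] [IsManifold (𝓡 3) ((⊤ : ℕ∞) : WithTop ℕ∞) X] [T2Space X] [SecondCountableTopology X] [ConnectedSpace X], let P : Literature.Geometry.Lorentzian.InitialDataSet (𝓡 3) X → Prop := fun D ↦ (∃ 𝒟 : Literature.Geometry.Lorentzian.VacuumCauchyDevelopment D, 𝒟.IsMaximal) ∧ ∀ 𝒟 : Literature.Geometry.Lorentzian.VacuumCauchyDevelopment D, 𝒟.IsMaximal → Summit.FinalStateConjecture.HasCompleteNullInfinity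 𝒟.toCauchyDevelopment ∧ ∃ (O : Set 𝒟.carrier) (d : Literature.Geometry.Lorentzian.FinalStateDecomposition 𝒟.toSpacetime O 2), (∀ i, Literature.Geometry.Lorentzian.Kerr.IsSubextremal (d.mass i) (d.spin i)) ∧ O = Summit.FinalStateConjecture.exteriorOf 𝒟.toCauchyDevelopment d.charted ∧ Summit.FinalStateConjecture.RaysStayInClosure 𝒟.toCauchyDevelopment O ∧ Summit.FinalStateConjecture.HasExhaustiveCharts d ∧ Summit.FinalStateConjecture.IsFutureOriented d; let Captured : Literature.Geometry.Lorentzian.InitialDataSet (𝓡 3) X → Prop := fun D ↦ (∃ 𝒟 : Literature.Geometry.Lorentzian.VacuumCauchyDevelopment D, 𝒟.IsMaximal) ∧ ∀ 𝒟 : Literature.Geometry.Lorentzian.VacuumCauchyDevelopment D, 𝒟.IsMaximal → Summit.FinalStateConjecture.HasCompleteNullInfinity 𝒟.toCauchyDevelopment ∧ ∀ δ : ENNReal, 0 < δ → ∃ (O : Set 𝒟.carrier) (q : Literature.Geometry.Lorentzian.QuasiFinalStateDecomposition 𝒟.toSpacetime O 2 δ), (∀ i, Literature.Geometry.Lorentzian.Kerr.IsSubextremal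 (q.mass i) (q.spin i)) ∧ O = Summit.FinalStateConjecture.exteriorOf 𝒟.toCauchyDevelopment q.charted ∧ Summit.FinalStateConjecture.RaysStayInClosure 𝒟.toCauchyDevelopment O ∧ (∃ R : Fin q.N → ℝ → ℝ, (∀ i, Tendsto (R i) atTop atTop ∧ ∀ τ, max (Literature.Geometry.Lorentzian.Kerr.rPlus (q.mass i) (q.spin i)) 0 + 1 ≤ R i τ) ∧ (∀ i, ∀ᶠ τ in atTop, 𝒟.toSpacetime.truncDeviationCk (q.background i) (q.chart i) 2 (R i τ) τ ≤ δ) ∧ ∀ τ₁ : ℝ, q.τ₀ < τ₁ → O \ q.certifiedLate R τ₁ ⊆ 𝒟.toSpacetime.metric.causalPast 𝒟.toSpacetime.timeOrientation (q.certifiedSlab R τ₁)) ∧ ((∀ i, Summit.FinalStateConjecture.IsOrthochronous (q.motion i).1) ∧ (∀ i (ρ : ℝ), ∀ᶠ τ in atTop, ∀ x ∈ (q.background i).truncTimeSlab ρ τ, 𝒟.toSpacetime.timeOrientation.IsFutureDirected (mfderiv 𝓘(ℝ, Literature.Geometry.Lorentzian.E4) (𝓡 4) (q.chart i) x (((q.motion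 i).1 : Literature.Geometry.Lorentzian.E4 ≃L[ℝ] Literature.Geometry.Lorentzian.E4) (Literature.Geometry.Lorentzian.Kerr.timeVector (q.mass i) (q.spin i) (Literature.Geometry.Lorentzian.poincareInv (q.motion i).1 (q.motion i).2 (x : Literature.Geometry.Lorentzian.E4)))))) ∧ ∀ᶠ τ in atTop, ∀ x ∈ (Literature.Geometry.Lorentzian.Minkowski.backgroundOn q.flatDomain).timeSlab τ, 𝒟.toSpacetime.timeOrientation.IsFutureDirected (mfderiv 𝓘(ℝ, Literature.Geometry.Lorentzian.E4) (𝓡 4) q.flatChart x (Literature.Geometry.Lorentzian.E4.basisVector 0))); let Q : Literature.Geometry.Lorentzian.InitialDataSet (𝓡 3) X → Prop := fun D ↦ (∃ 𝒟 : Literature.Geometry.Lorentzian.VacuumCauchyDevelopment D, 𝒟.IsMaximal) ∧ ∀ 𝒟 : Literature.Geometry.Lorentzian.VacuumCauchyDevelopment D, 𝒟.IsMaximal → Summit.FinalStateConjecture.HasCompleteNullInfinity 𝒟.toCauchyDevelopment ∧ ∃ (O : Set 𝒟.carrier) (q : Literature.Geometry.Lorentzian.QuasiFinalStateDecomposition 𝒟.toSpacetime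 O 2 1), (∀ i, Literature.Geometry.Lorentzian.Kerr.IsSubextremal (q.mass i) (q.spin i)) ∧ O = Summit.FinalStateConjecture.exteriorOf 𝒟.toCauchyDevelopment q.charted ∧ Summit.FinalStateConjecture.RaysStayInClosure 𝒟.toCauchyDevelopment O ∧ (∃ R : Fin q.N → ℝ → ℝ, (∀ i, Tendsto (R i) atTop atTop ∧ ∀ τ, max (Literature.Geometry.Lorentzian.Kerr.rPlus (q.mass i) (q.spin i)) 0 + 1 ≤ R i τ) ∧ (∀ i, ∀ᶠ τ in atTop, 𝒟.toSpacetime.truncDeviationCk (q.background i) (q.chart i) 2 (R i τ) τ ≤ 1) ∧ ∀ τ₁ : ℝ, q.τ₀ < τ₁ → O \ q.certifiedLate R τ₁ ⊆ 𝒟.toSpacetime.metric.causalPast 𝒟.toSpacetime.timeOrientation (q.certifiedSlab R τ₁)) ∧ ((∀ i, Summit.FinalStateConjecture.IsOrthochronous (q.motion i).1) ∧ (∀ i (ρ : ℝ), ∀ᶠ τ in atTop, ∀ x ∈ (q.background i).truncTimeSlab ρ τ, 𝒟.toSpacetime.timeOrientation.IsFutureDirected (mfderiv 𝓘(ℝ,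 Literature.Geometry.Lorentzian.E4) (𝓡 4) (q.chart i) x (((q.motion i).1 : Literature.Geometry.Lorentzian.E4 ≃L[ℝ] Literature.Geometry.Lorentzian.E4) (Literature.Geometry.Lorentzian.Kerr.timeVector (q.mass i) (q.spin i) (Literature.Geometry.Lorentzian.poincareInv (q.motion i).1 (q.motion i).2 (x : Literature.Geometry.Lorentzian.E4)))))) ∧ ∀ᶠ τ in atTop, ∀ x ∈ (Literature.Geometry.Lorentzian.Minkowski.backgroundOn q.flatDomain).timeSlab τ, 𝒟.toSpacetime.timeOrientation.IsFutureDirected (mfderiv 𝓘(ℝ, Literature.Geometry.Lorentzian.E4) (𝓡 4) q.flatChart x (Literature.Geometry.Lorentzian.E4.basisVector 0))); ∀ d ∈ Literature.Geometry.Lorentzian.admissibleVacuumData X, ¬ P d → Q d → ¬ Captured d → ∃ (e : Literature.Geometry.Lorentzian.AFEnd X) (F : EuclideanSpace ℝ (Fin 1) → Literature.Geometry.Lorentzian.InitialDataSet (𝓡 3) X), Literature.Geometry.Lorentzian.InitialDataSet.IsTameDataFamily e 1 F ∧ Literature.Geometry.Lorentzian.InitialDataSet.IsImmersedAtZero 1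 F ∧ F 0 = d ∧ Injective F ∧ (∀ c, F c ∈ Literature.Geometry.Lorentzian.admissibleVacuumData X) ∧ ∀ c ≠ 0, P (F c)

/-- item stmt-FinalStateConjecture-25327 · crux · rank 4 · open · by planner
why it might fail: a Cantor-like set of P-bad parameters accumulating at 0 along every Q-exit line through some Q-exceptional datum (laminated ringdown failure inside the unit shadow) gives a Q-exit with no P-exit.
sources: Christodoulou1999, arXiv:gr-qc/0702084, Klainerman2025
[crux (thin) · gen-2 glued split of WildCell (stmt-24308), lens-6 g2; WEAKER (vacuous under S: lens
kernel ringdownJunction_of_summit) · UNDECIDED — stated test: tame general position of 𝓔 ∩ Q along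
coarse-capture lines (is the bad parameter set {c ≠ 0 | ¬P_Σ (F c)} locally finite near 0 on the
lines GenericCoarseCapture produces? yes ⇒ reduces to MesoscopicRingdown by re-basing); the typed
∧-TAX of the relative door (tree negative isTameChristodoulouGeneric_and_fails: tame genericity is
not ∧-closed, so A and B₁′ do not compose without it)] For every Σ, at every admissible
P_Σ-exceptional datum FAILING the unit shadow Q_Σ, a tame immersed injective admissible exit line
into Q_Σ yields a tame immersed injective admissible exit line into P_Σ (possibly another line,
another end). -/
@[route_item "route-FinalStateConjecture-RootDecompShadowCensorship", crux]
def RingdownJunction : Prop :=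
  ∀ (X : Type) [TopologicalSpace X] [ChartedSpace Literature.Geometry.Lorentzian.E3 X] [IsManifold (𝓡 3) ((⊤ : ℕ∞) : WithTop ℕ∞) X] [T2Space X] [SecondCountableTopology X] [ConnectedSpace X], let P : Literature.Geometry.Lorentzian.InitialDataSet (𝓡 3) X → Prop := fun D ↦ (∃ 𝒟 : Literature.Geometry.Lorentzian.VacuumCauchyDevelopment D, 𝒟.IsMaximal) ∧ ∀ 𝒟 : Literature.Geometry.Lorentzian.VacuumCauchyDevelopment D, 𝒟.IsMaximal → Summit.FinalStateConjecture.HasCompleteNullInfinity 𝒟.toCauchyDevelopment ∧ ∃ (O : Set 𝒟.carrier) (d : Literature.Geometry.Lorentzian.FinalStateDecomposition 𝒟.toSpacetime O 2), (∀ i, Literature.Geometry.Lorentzian.Kerr.IsSubextremal (d.mass i) (d.spin i)) ∧ O = Summit.FinalStateConjecture.exteriorOf 𝒟.toCauchyDevelopment d.charted ∧ Summit.FinalStateConjecture.RaysStayInClosure 𝒟.toCauchyDevelopment O ∧ Summit.FinalStateConjecture.HasExhaustiveCharts d ∧ Summit.FinalStateConjecture.IsFutureOriented d; let Q : Literature.Geometry.Lorentzian.InitialDataSet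 (𝓡 3) X → Prop := fun D ↦ (∃ 𝒟 : Literature.Geometry.Lorentzian.VacuumCauchyDevelopment D, 𝒟.IsMaximal) ∧ ∀ 𝒟 : Literature.Geometry.Lorentzian.VacuumCauchyDevelopment D, 𝒟.IsMaximal → Summit.FinalStateConjecture.HasCompleteNullInfinity 𝒟.toCauchyDevelopment ∧ ∃ (O : Set 𝒟.carrier) (q : Literature.Geometry.Lorentzian.QuasiFinalStateDecomposition 𝒟.toSpacetime O 2 1), (∀ i, Literature.Geometry.Lorentzian.Kerr.IsSubextremal (q.mass i) (q.spin i)) ∧ O = Summit.FinalStateConjecture.exteriorOf 𝒟.toCauchyDevelopment q.charted ∧ Summit.FinalStateConjecture.RaysStayInClosure 𝒟.toCauchyDevelopment O ∧ (∃ R : Fin q.N → ℝ → ℝ, (∀ i, Tendsto (R i) atTop atTop ∧ ∀ τ, max (Literature.Geometry.Lorentzian.Kerr.rPlus (q.mass i) (q.spin i)) 0 + 1 ≤ R i τ) ∧ (∀ i, ∀ᶠ τ in atTop, 𝒟.toSpacetime.truncDeviationCk (q.background i) (q.chart i) 2 (R i τ) τ ≤ 1) ∧ ∀ τ₁ : ℝ,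 q.τ₀ < τ₁ → O \ q.certifiedLate R τ₁ ⊆ 𝒟.toSpacetime.metric.causalPast 𝒟.toSpacetime.timeOrientation (q.certifiedSlab R τ₁)) ∧ ((∀ i, Summit.FinalStateConjecture.IsOrthochronous (q.motion i).1) ∧ (∀ i (ρ : ℝ), ∀ᶠ τ in atTop, ∀ x ∈ (q.background i).truncTimeSlab ρ τ, 𝒟.toSpacetime.timeOrientation.IsFutureDirected (mfderiv 𝓘(ℝ, Literature.Geometry.Lorentzian.E4) (𝓡 4) (q.chart i) x (((q.motion i).1 : Literature.Geometry.Lorentzian.E4 ≃L[ℝ] Literature.Geometry.Lorentzian.E4) (Literature.Geometry.Lorentzian.Kerr.timeVector (q.mass i) (q.spin i) (Literature.Geometry.Lorentzian.poincareInv (q.motion i).1 (q.motion i).2 (x : Literature.Geometry.Lorentzian.E4)))))) ∧ ∀ᶠ τ in atTop, ∀ x ∈ (Literature.Geometry.Lorentzian.Minkowski.backgroundOn q.flatDomain).timeSlab τ, 𝒟.toSpacetime.timeOrientation.IsFutureDirected (mfderiv 𝓘(ℝ, Literature.Geometry.Lorentzian.E4) (𝓡 4) q.flatChart x (Literature.Geometry.Lorentzian.E4.basisVector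 0))); ∀ d ∈ Literature.Geometry.Lorentzian.admissibleVacuumData X, ¬ P d → ¬ Q d → (∃ (e : Literature.Geometry.Lorentzian.AFEnd X) (F : EuclideanSpace ℝ (Fin 1) → Literature.Geometry.Lorentzian.InitialDataSet (𝓡 3) X), Literature.Geometry.Lorentzian.InitialDataSet.IsTameDataFamily e 1 F ∧ Literature.Geometry.Lorentzian.InitialDataSet.IsImmersedAtZero 1 F ∧ F 0 = d ∧ Injective F ∧ (∀ c, F c ∈ Literature.Geometry.Lorentzian.admissibleVacuumData X) ∧ ∀ c ≠ 0, Q (F c)) → ∃ (e : Literature.Geometry.Lorentzian.AFEnd X) (F : EuclideanSpace ℝ (Fin 1) → Literature.Geometry.Lorentzian.InitialDataSet (𝓡 3) X), Literature.Geometry.Lorentzian.InitialDataSet.IsTameDataFamily e 1 F ∧ Literature.Geometry.Lorentzian.InitialDataSet.IsImmersedAtZero 1 F ∧ F 0 = d ∧ Injective F ∧ (∀ c, F c ∈ Literature.Geometry.Lorentzian.admissibleVacuumData X) ∧ ∀ c ≠ 0, P (F c)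

/-- item stmt-FinalStateConjecture-24307 · crux · rank 5 · open · by planner
why it might fail: data whose MGHDs converge to an EXACTLY EXTREMAL Kerr exterior might fill a tame-open set (third law false in the charged model, arXiv:2211.15742; extremal formation conjectured critical = positive codimension, arXiv:2402.10190, unproved in vacuum).
sources: Klainerman2025, arXiv:2211.15742, arXiv:2402.10190, KlainermanSzeftel2020, Hintz2026
[crux] PIECE A — PerturbativeCell [WEAKER — critic CLEARED 2026-08-30T01:32:21Z: «S∖WildCell is
NAMED and non-empty: concrete member = the exact EXTREMAL Kerr datum … hard members = dynamically
forming exactly-extremal holes»; leaves ThirdLawCell WEAKER·IDEA-NEEDED, Stitching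
UNDECIDED·ATTACKABLE (aside items below); BARRIER AretakisInstability on every uniform-basin road].
For every Σ and every admissible P_Σ-exceptional datum d that IS captured (an MGHD exists; every
MGHD has complete 𝓘⁺ and, for every δ > 0, a sub-extremal δ-quasi final state decomposition with O =
exteriorOf q.charted, rays in closure O, honest-radii quasi-exhaustive future-oriented charts),
there are ONE asymptotically flat end e and a tame (IsTameDataFamily e 1), immersed-at-0, injective
one-parameter family F of admissible data with F 0 = d all of whose members c ≠ 0 satisfy P_Σ.
Content: the generic third law (extremal parameter limits), gauge stitching of δ-indexed chart
systems, label convergence in the closed range. [difficulty: open-problem] -/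
@[route_item "route-FinalStateConjecture-RootDecompShadowCensorship", crux]
def PerturbativeCell : Prop :=
  ∀ (X : Type) [TopologicalSpace X] [ChartedSpace Literature.Geometry.Lorentzian.E3 X] [IsManifold (𝓡 3) ((⊤ : ℕ∞) : WithTop ℕ∞) X] [T2Space X] [SecondCountableTopology X] [ConnectedSpace X], let P : Literature.Geometry.Lorentzian.InitialDataSet (𝓡 3) X → Prop := fun D ↦ (∃ 𝒟 : Literature.Geometry.Lorentzian.VacuumCauchyDevelopment D, 𝒟.IsMaximal) ∧ ∀ 𝒟 : Literature.Geometry.Lorentzian.VacuumCauchyDevelopment D, 𝒟.IsMaximal → Summit.FinalStateConjecture.HasCompleteNullInfinity 𝒟.toCauchyDevelopment ∧ ∃ (O : Set 𝒟.carrier) (d : Literature.Geometry.Lorentzian.FinalStateDecomposition 𝒟.toSpacetime O 2), (∀ i, Literature.Geometry.Lorentzian.Kerr.IsSubextremal (d.mass i) (d.spin i)) ∧ O = Summit.FinalStateConjecture.exteriorOf 𝒟.toCauchyDevelopment d.charted ∧ Summit.FinalStateConjecture.RaysStayInClosure 𝒟.toCauchyDevelopment O ∧ Summit.FinalStateConjecture.HasExhaustiveCharts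 d ∧ Summit.FinalStateConjecture.IsFutureOriented d; let Captured : Literature.Geometry.Lorentzian.InitialDataSet (𝓡 3) X → Prop := fun D ↦ (∃ 𝒟 : Literature.Geometry.Lorentzian.VacuumCauchyDevelopment D, 𝒟.IsMaximal) ∧ ∀ 𝒟 : Literature.Geometry.Lorentzian.VacuumCauchyDevelopment D, 𝒟.IsMaximal → Summit.FinalStateConjecture.HasCompleteNullInfinity 𝒟.toCauchyDevelopment ∧ ∀ δ : ENNReal, 0 < δ → ∃ (O : Set 𝒟.carrier) (q : Literature.Geometry.Lorentzian.QuasiFinalStateDecomposition 𝒟.toSpacetime O 2 δ), (∀ i, Literature.Geometry.Lorentzian.Kerr.IsSubextremal (q.mass i) (q.spin i)) ∧ O = Summit.FinalStateConjecture.exteriorOf 𝒟.toCauchyDevelopment q.charted ∧ Summit.FinalStateConjecture.RaysStayInClosure 𝒟.toCauchyDevelopment O ∧ (∃ R : Fin q.N → ℝ → ℝ, (∀ i, Tendsto (R i) atTop atTop ∧ ∀ τ, max (Literature.Geometry.Lorentzian.Kerr.rPlus (q.mass i) (q.spin i)) 0 + 1 ≤ R i τ) ∧ (∀ i, ∀ᶠ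 τ in atTop, 𝒟.toSpacetime.truncDeviationCk (q.background i) (q.chart i) 2 (R i τ) τ ≤ δ) ∧ ∀ τ₁ : ℝ, q.τ₀ < τ₁ → O \ q.certifiedLate R τ₁ ⊆ 𝒟.toSpacetime.metric.causalPast 𝒟.toSpacetime.timeOrientation (q.certifiedSlab R τ₁)) ∧ ((∀ i, Summit.FinalStateConjecture.IsOrthochronous (q.motion i).1) ∧ (∀ i (ρ : ℝ), ∀ᶠ τ in atTop, ∀ x ∈ (q.background i).truncTimeSlab ρ τ, 𝒟.toSpacetime.timeOrientation.IsFutureDirected (mfderiv 𝓘(ℝ, Literature.Geometry.Lorentzian.E4) (𝓡 4) (q.chart i) x (((q.motion i).1 : Literature.Geometry.Lorentzian.E4 ≃L[ℝ] Literature.Geometry.Lorentzian.E4) (Literature.Geometry.Lorentzian.Kerr.timeVector (q.mass i) (q.spin i) (Literature.Geometry.Lorentzian.poincareInv (q.motion i).1 (q.motion i).2 (x : Literature.Geometry.Lorentzian.E4)))))) ∧ ∀ᶠ τ in atTop, ∀ x ∈ (Literature.Geometry.Lorentzian.Minkowski.backgroundOn q.flatDomain).timeSlab τ, 𝒟.toSpacetime.timeOrientation.IsFutureDirected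 (mfderiv 𝓘(ℝ, Literature.Geometry.Lorentzian.E4) (𝓡 4) q.flatChart x (Literature.Geometry.Lorentzian.E4.basisVector 0))); ∀ d ∈ Literature.Geometry.Lorentzian.admissibleVacuumData X, ¬ P d → Captured d → ∃ (e : Literature.Geometry.Lorentzian.AFEnd X) (F : EuclideanSpace ℝ (Fin 1) → Literature.Geometry.Lorentzian.InitialDataSet (𝓡 3) X), Literature.Geometry.Lorentzian.InitialDataSet.IsTameDataFamily e 1 F ∧ Literature.Geometry.Lorentzian.InitialDataSet.IsImmersedAtZero 1 F ∧ F 0 = d ∧ Injective F ∧ (∀ c, F c ∈ Literature.Geometry.Lorentzian.admissibleVacuumData X) ∧ ∀ c ≠ 0, P (F c)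

/-- item stmt-FinalStateConjecture-26975 · assembly · rank 1 · closed · moot by None · by planner
sources: Christodoulou1999
[assembly] GenericCoarseCapture → MesoscopicRingdown → RingdownJunction → PerturbativeCell → the
final state conjecture as typed. -/
@[route_item "route-FinalStateConjecture-RootDecompShadowCensorship"]
def Assembly : Prop :=
  GenericCoarseCapture → MesoscopicRingdown → RingdownJunction → PerturbativeCell → FinalStateConjecture

/-! D-0027 §2.1 — DECIDING THEOREM (planner-authored via `route open/edit --closes-file`; by planner-decomp-fsc-writer-1-g0-0 2026-08-30T03:48:58Z) — ARCHIVED: route closed (superseded) 2026-08-30T03:54:42Z; kept so importers keep building: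
its hypotheses are this route's items and its conclusion the sub-problem Statement (glue_lint), and it elaborates with this file. -/

@[closes "route-FinalStateConjecture-RootDecompShadowCensorship"] theorem closes (hG : GenericCoarseCapture) (hM : MesoscopicRingdown) (hJ : RingdownJunction) (hPC : PerturbativeCell) : _root_.FinalStateConjecture := by
  intro X _ _ _ _ _ _ d hd
  suffices h : ∃ (e : Literature.Geometry.Lorentzian.AFEnd X) (F : EuclideanSpace ℝ (Fin 1) → Literature.Geometry.Lorentzian.InitialDataSet (𝓡 3) X), Literature.Geometry.Lorentzian.InitialDataSet.IsTameDataFamily e 1 F ∧ Literature.Geometry.Lorentzian.InitialDataSet.IsImmersedAtZero 1 F ∧ F 0 = d ∧ Injective F ∧ (∀ c, F c ∈ Literature.Geometry.Lorentzian.admissibleVacuumData X) ∧ ∀ c ≠ 0, ((∃ 𝒟 : Literature.Geometry.Lorentzian.VacuumCauchyDevelopment (F c), 𝒟.IsMaximal) ∧ ∀ 𝒟 : Literature.Geometry.Lorentzian.VacuumCauchyDevelopment (F c), 𝒟.IsMaximal → Summit.FinalStateConjecture.HasCompleteNullInfinity 𝒟.toCauchyDevelopment ∧ ∃ (O : Set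 𝒟.carrier) (d : Literature.Geometry.Lorentzian.FinalStateDecomposition 𝒟.toSpacetime O 2), (∀ i, Literature.Geometry.Lorentzian.Kerr.IsSubextremal (d.mass i) (d.spin i)) ∧ O = Summit.FinalStateConjecture.exteriorOf 𝒟.toCauchyDevelopment d.charted ∧ Summit.FinalStateConjecture.RaysStayInClosure 𝒟.toCauchyDevelopment O ∧ Summit.FinalStateConjecture.HasExhaustiveCharts d ∧ Summit.FinalStateConjecture.IsFutureOriented d) by
    obtain ⟨e, F, h1, h2, h3, h4, h5, h6⟩ := h
    exact ⟨e, F, h1, h2, h3, h4, h5, fun c hc hmem ↦ hmem.2 (h6 c hc)⟩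
  -- excluded middle on «d is captured»: PerturbativeCell cures the captured case; else MesoscopicRingdown if the unit shadow Q holds at d,
  -- else GenericCoarseCapture's Q-exit through d is upgraded to a P-exit by RingdownJunction
  by_contra hne
  refine hne (hPC X d hd.1 hd.2 (Classical.not_not.mp fun hCap ↦ hne ?_))
  have key := fun hQ ↦ hne (hM X d hd.1 hd.2 hQ hCap)
  obtain ⟨e, F, g1, g2, g3, g4, g5, g6⟩ := hG X d ⟨hd.1, key⟩
  exact hJ X d hd.1 hd.2 key ⟨e, F, g1, g2, g3, g4, g5, fun c hc ↦ Classical.not_not.mp fun hn ↦ g6 c hc ⟨g5 c, hn⟩⟩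

end Summit.FinalStateConjecture.FinalStateConjecture.Theses.RootDecompShadowCensorship
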